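import Summits.Ventures.PercRepro.S2ClusterRowsFour

/-!
# PercRepro — S2: THE ROWS `t ≤ 3` OF THE CELL `(13, 6)` MODULO THE SPREAD CAPS `(30, 77, 112)` (p7, gen 15; sub-claim S2)

The coloop-free spread rows `t ≤ 3` of the cell `(13, 6)` close on the hitting lever of the cell `(14, 6)` once the three circuit
counts of the spread core are capped by `s₄ ≤ 30`, `s₅ ≤ 77`, `s₆ ≤ 112` (p1's spread chains: `s₄ ≤ ⌊19 · 24 / 15⌋`,
`s₅ ≤ ⌊19 · 57 / 14⌋`, `s₆ ≤ ⌊19 · 77 / 13⌋`; here HYPOTHESES): **`c025_thirteen_six_cf_spread_le_three_of_caps`** — at `t = 0`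
two `4`-circuits (`U ≤ 15506` against `16238`), two `5`-circuits (`12797`) or neither (`11859`); at `t = 1` the triangle with a
`4`-circuit (`15736` against `16201`), a `5`-circuit (`12916`) or neither (`12300`); at `t = 2` the two triangles (`15801` against
`16164`); at `t = 3` the three-triangle bound (`9846 + 6020 = 15866` against `16664`). With `c025_core_five_thirteen_six_of_three`:
**`c025_core_five_thirteen_six_of_caps`** — THE CELL `(13, 6)` MODULO THE THREE CAPS ON ITS COLOOP-FREE SPREAD CORE.
Nothing about any cell is claimed; the window of record is `8 ≤ p ≤ 14`. Axioms: standard.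
-/

open scoped Matroid

namespace PercRepro

namespace ThmN

open Set

variable {α : Type}

/-- The three-triangle top-`5` bound at `19` points: `x ≤ 9846`. -/
theorem top_five_le_of_three_bound19 (x a b c : ℕ) (ha1 : 13 ≤ a) (ha2 : a ≤ 14) (hb1 : 13 ≤ b) (hb2 : b ≤ 14)
    (hc1 : 10 ≤ c) (hc2 : c ≤ 13) (hca : c + 1 ≤ a) (hcb : c + 1 ≤ b)
    (h : x + a.choose 5 + b.choose 5 ≤ 11628 + c.choose 5) :
    x ≤ 9846 := by
  interval_cases a <;> interval_cases b <;> interval_cases c <;> norm_num [Nat.choose] at h <;> omega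

/-- **The coloop-free spread rows `t ≤ 3` of the cell `(13, 6)` modulo the spread caps `s₄ ≤ 30`, `s₅ ≤ 77`, `s₆ ≤ 112`.** -/
theorem c025_thirteen_six_cf_spread_le_three_of_caps (M : Matroid α) [M.Finite]
    (hR : M.eRank = ((13 : ℕ) : ℕ∞)) (hn : M.E.ncard = 13 + 6)
    (hfree : ∀ e ∈ M.E, ∃ A ⊆ M.E \ {e}, e ∉ M.closure A ∧ e ∉ M.closure ((M.E \ {e}) \ A)) (hK : ∀ e, ¬ M.IsColoop e)
    (h4 : ¬ ∃ W ⊆ M.E, W.ncard ≤ 9 ∧ W.encard = M.eRk W + 4)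
    (hs4c : {C : Set α | M.IsCircuit C ∧ C.ncard = 4}.ncard ≤ 30)
    (hs5c : {C : Set α | M.IsCircuit C ∧ C.ncard = 5}.ncard ≤ 77)
    (hs6c : {C : Set α | M.IsCircuit C ∧ C.ncard = 6}.ncard ≤ 112)
    (ht3 : {C : Set α | M.IsCircuit C ∧ C.ncard = 3}.ncard ≤ 3) : RLS M 13 5 := by
  classical
  have hd : M.E.encard = M.eRank + ((6 : ℕ) : ℕ∞) := by
    rw [hR, ← M.ground_finite.cast_ncard_eq, hn]
    push_cast
    ring
  obtain ⟨hs3, -, -⟩ := caps_thirteen_six_cf M hd hn hfree hK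
  have hflat : ∀ X ⊆ M.E, M.eRk X ≤ 5 → X.ncard ≤ 8 := fun X hX hr => by
    have := S2.ncard_le_of_eRk_le_of_not_nullity M 4 9 (by norm_num) h4 hX (r := 5) (by norm_num) (by exact_mod_cast hr)
    omega
  have hflat' : ∀ X ⊆ M.E, M.eRk X ≤ 4 → X.ncard ≤ 7 := fun X hX hr => by
    have := S2.ncard_le_of_eRk_le_of_not_nullity M 4 9 (by norm_num) h4 hX (r := 4) (by norm_num) (by exact_mod_cast hr)
    omega
  have hEcard : M.ground_finite.toFinset.card = 13 + 6 := by
    rw [← Set.ncard_eq_toFinset_card _ M.ground_finite]; exact hn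
  have hL0 : ∀ e ∈ M.E, ¬ M.IsLoop e := not_isLoop_of_free M hfree
  have hs : ∀ e ∈ M.E, ∀ f ∈ M.E, e ≠ f → M.eRk {e, f} = 2 := by
    intro e he f hf hef
    have h2 : (2 : ℕ∞) ≤ M.eRk {e, f} :=
      two_le_eRk_of_two_le_ncard_of_free M hfree (pair_subset he hf) (by rw [ncard_pair hef])
    have h3 : M.eRk {e, f} ≤ 2 := by
      have := M.eRk_le_encard {e, f}
      rwa [encard_pair hef] at this
    exact le_antisymm h3 h2
  have hC1 : ∀ L ⊆ M.E, M.eRk L = 2 → L.ncard ≤ 3 :=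
    fun L hL hr => ncard_le_three_of_eRk_two M hs hfree hL hr
  have hcirc : ∀ C, M.IsCircuit C → 3 ≤ C.encard := three_le_encard_of_circuit M hL0 hs
  have hTfin : {C : Set α | M.IsCircuit C ∧ C.ncard = 3}.Finite :=
    M.ground_finite.finite_subsets.subset (fun C hC => hC.1.subset_ground)
  have h4fin : {C : Set α | M.IsCircuit C ∧ C.ncard = 4}.Finite :=
    M.ground_finite.finite_subsets.subset (fun C hC => hC.1.subset_ground)
  have h5fin : {C : Set α | M.IsCircuit C ∧ C.ncard = 5}.Finite :=
    M.ground_finite.finite_subsets.subset (fun C hC => hC.1.subset_ground)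
  have hfin : ∀ {T : Set α}, M.IsCircuit T → T.Finite := fun hT => M.ground_finite.subset hT.subset_ground
  -- the cell inequality with `K = 9480`, `Φ(13, 5) = 1742 / 63 ≤ 2^18 / 9480`
  have cellA : ∀ (U S m : ℕ) (A : ℚ), Matroid.topCount M 13 5 ≤ U →
      {X : Set α | X ⊆ M.E ∧ M.eRk X = M.eRank}.ncard ≤ S → m ≤ 1024 →
      1024 * (U : ℚ) ≤ ((1024 - m : ℕ) : ℚ) * 2 ^ (6 - 5) * (9480 : ℚ) →
      (1024 : ℚ) * (A + (S : ℚ)) ≤ (m : ℚ) * 2 ^ 19 →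
      ({X : Set α | X ⊆ M.E ∧ M.eRk X ≤ 5}.ncard : ℚ) ≤ A → RLS M 13 5 := by
    intro U S m A hU hS hm hpoly htail hA
    rw [RLS_iff]
    exact c025_core_five_cell_of_counts_xqictq5g M 13 6 (by norm_num) hR hn U hU _ hA S hS
      9480 (by norm_num) (phiK 13 5) (by rw [phiK_thirteen_five]; norm_num) ⟨m, hm, hpoly, htail⟩
  -- the top count is the top `5`-sets plus the top `6`-sets
  have hU1 := S2.topCount_le_ncard_compl_spanning (M := M) hR hd 5
  simp only [Nat.cast_ofNat] at hU1
  have hsplit : {B : Set α | B ⊆ M.E ∧ M.eRk B = 5 ∧ B.ncard ≤ 6 ∧ M.eRk (M.E \ B) = M.eRank}.ncard ≤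
      {B : Set α | B ⊆ M.E ∧ B.ncard = 5 ∧ M.eRk B = 5 ∧ M.eRk (M.E \ B) = M.eRank}.ncard +
      {B : Set α | B ⊆ M.E ∧ B.ncard = 6 ∧ M.eRk B = 5 ∧ M.eRk (M.E \ B) = M.eRank}.ncard := by
    refine le_trans (Set.ncard_le_ncard ?_ ((M.ground_finite.finite_subsets.subset (fun B hB => hB.1)).union
      (M.ground_finite.finite_subsets.subset (fun B hB => hB.1)))) (Set.ncard_union_le _ _)
    rintro B ⟨hBE, hB5, hB6, hBs⟩
    have hBfin : B.Finite := M.ground_finite.subset hBE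
    have h5le : 5 ≤ B.ncard := by
      have := M.eRk_le_encard B
      rw [hB5, ← hBfin.cast_ncard_eq] at this
      exact_mod_cast this
    rcases (show B.ncard = 5 ∨ B.ncard = 6 by omega) with h | h
    · exact Or.inl ⟨hBE, h, hB5, hBs⟩
    · exact Or.inr ⟨hBE, h, hB5, hBs⟩
  have hUsum : Matroid.topCount M 13 5 ≤
      {B : Set α | B ⊆ M.E ∧ B.ncard = 5 ∧ M.eRk B = 5 ∧ M.eRk (M.E \ B) = M.eRank}.ncard +
      {B : Set α | B ⊆ M.E ∧ B.ncard = 6 ∧ M.eRk B = 5 ∧ M.eRk (M.E \ B) = M.eRank}.ncard := hU1.trans hsplit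
  -- the top `5`-sets against two sets they all meet
  have htop5_le : ∀ (Y₁ Y₂ : Set α), (∀ B ⊆ M.E, B.ncard = 5 → M.eRk (M.E \ B) = M.eRank → (B ∩ Y₁).Nonempty) →
      (∀ B ⊆ M.E, B.ncard = 5 → M.eRk (M.E \ B) = M.eRank → (B ∩ Y₂).Nonempty) →
      {B : Set α | B ⊆ M.E ∧ B.ncard = 5 ∧ M.eRk B = 5 ∧ M.eRk (M.E \ B) = M.eRank}.ncard +
        (M.E \ Y₁).ncard.choose 5 + (M.E \ Y₂).ncard.choose 5 ≤ 11628 + (M.E \ (Y₁ ∪ Y₂)).ncard.choose 5 := by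
    intro Y₁ Y₂ h1 h2
    have := S2.ncard_top_five_add_le_of_hit M Y₁ Y₂ h1 h2
    rw [hn] at this
    norm_num [Nat.choose] at this
    exact this
  have htop5_all : {B : Set α | B ⊆ M.E ∧ B.ncard = 5 ∧ M.eRk B = 5 ∧ M.eRk (M.E \ B) = M.eRank}.ncard ≤ 11628 := by
    have hsub : {B : Set α | B ⊆ M.E ∧ B.ncard = 5 ∧ M.eRk B = 5 ∧ M.eRk (M.E \ B) = M.eRank} ⊆
        {X : Set α | X ⊆ M.E ∧ X.ncard = 5} := fun B hB => ⟨hB.1, hB.2.1⟩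
    have := Set.ncard_le_ncard hsub (M.ground_finite.finite_subsets.subset (fun X hX => hX.1))
    rw [S2.ncard_subsets_ncard_eq M.E M.ground_finite 5, hn] at this
    norm_num [Nat.choose] at this
    exact this
  -- the complement of a union of two circuits: `|E ∖ (C₁ ∪ C₂)| ≥ 19 − |C₁| − |C₂|`
  have hcompl : ∀ {C₁ C₂ : Set α}, C₁ ⊆ M.E → C₂ ⊆ M.E → 19 ≤ (M.E \ (C₁ ∪ C₂)).ncard + C₁.ncard + C₂.ncard := by
    intro C₁ C₂ h₁ h₂
    have hY : C₁ ∪ C₂ ⊆ M.E := Set.union_subset h₁ h₂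
    have h := Set.ncard_sdiff_add_ncard_of_subset hY M.ground_finite
    have hu := Set.ncard_union_le C₁ C₂
    omega
  -- the top `6`-sets through circuits, with the per-triangle charge `560` and the three caps
  have htop6 : {B : Set α | B ⊆ M.E ∧ B.ncard = 6 ∧ M.eRk B = 5 ∧ M.eRk (M.E \ B) = M.eRank}.ncard ≤
      {C : Set α | M.IsCircuit C ∧ C.ncard = 3}.ncard * 560 + {C : Set α | M.IsCircuit C ∧ C.ncard = 4}.ncard * 105 +
        {C : Set α | M.IsCircuit C ∧ C.ncard = 5}.ncard * 14 + {C : Set α | M.IsCircuit C ∧ C.ncard = 6}.ncard := by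
    have hc560 : ∀ T : Set α, M.IsCircuit T → T.ncard = 3 →
        {B : Set α | B ⊆ M.E ∧ B.ncard = 6 ∧ T ⊆ B ∧ M.eRk (M.E \ B) = M.eRank}.ncard ≤ 560 := by
      intro T hT hT3
      have hsub : {B : Set α | B ⊆ M.E ∧ B.ncard = 6 ∧ T ⊆ B ∧ M.eRk (M.E \ B) = M.eRank} ⊆
          {X : Set α | X ⊆ M.E ∧ X.ncard = 6 ∧ T ⊆ X} := fun B hB => ⟨hB.1, hB.2.1, hB.2.2.1⟩
      have h := (Set.ncard_le_ncard hsub (M.ground_finite.finite_subsets.subset (fun X hX => hX.1))).trans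
        (S2.ncard_subsets_superset_le M hT.subset_ground 6)
      rw [hn, hT3] at h
      norm_num [Nat.choose] at h
      exact h
    have := S2.ncard_top_six_le M hn hcirc 560 hc560
    norm_num [Nat.choose] at this
    exact this
  -- the spanning counts: all sets of corank `≤ 6`, and the three-triangle Bonferroni
  have hSkit : {X : Set α | X ⊆ M.E ∧ M.eRk X = M.eRank}.ncard ≤ 43796 := by
    have hS := Matroid.ncard_spanning_le (M := M) hd
    rw [hEcard] at hS
    exact hS.trans (by decide)
  have hspan3 : 3 ≤ {C : Set α | M.IsCircuit C ∧ C.ncard = 3}.ncard →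
      {X : Set α | X ⊆ M.E ∧ M.eRk X = M.eRank}.ncard ≤ 28781 := by
    intro h3
    obtain ⟨T₁, T₂, T₃, hT₁, hT₂, hT₃, h12, h13, h23⟩ := (Set.two_lt_ncard_iff hTfin).1 (by omega)
    have hS := S2.ncard_spanning_add_le_of_three_triangles M hR hn (by norm_num) hC1 hT₁.1 hT₁.2 hT₂.1 hT₂.2
      hT₃.1 hT₃.2 h12 h13 h23
    norm_num [Finset.sum_range_succ, Nat.choose] at hS
    omega
  -- the exact triangle count `t ≤ 3` and the rank part of the tail at `t` with the caps `30`, `77`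
  obtain ⟨t, ht⟩ : ∃ t, {C : Set α | M.IsCircuit C ∧ C.ncard = 3}.ncard = t := ⟨_, rfl⟩
  have hA := ncard_eRk_le_five_le_spread M 13 6 (by norm_num) hR hn hfree hflat hflat' t 30 77 ht.le hs4c hs5c
  rw [ht] at hs3 hspan3 htop6 ht3
  by_cases ht0 : t = 0
  · subst ht0
    by_cases h42 : 2 ≤ {C : Set α | M.IsCircuit C ∧ C.ncard = 4}.ncard
    · -- two `4`-circuits: every top `5`-set meets their union of `≤ 8` points
      obtain ⟨C₁, C₂, hC₁, hC₂, hne⟩ := (Set.one_lt_ncard_iff h4fin).1 (by omega)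
      have hhit := S2.top_five_inter_union_nonempty M hR hn hC₁.1 hC₂.1 hne
      have h5b := htop5_le (C₁ ∪ C₂) (C₁ ∪ C₂) hhit hhit
      rw [Set.union_self] at h5b
      have hY := hcompl hC₁.1.subset_ground hC₂.1.subset_ground
      rw [hC₁.2, hC₂.2] at hY
      have hch : (11 : ℕ).choose 5 ≤ (M.E \ (C₁ ∪ C₂)).ncard.choose 5 := Nat.choose_le_choose 5 (by omega)
      norm_num [Nat.choose] at hch
      have hU' : Matroid.topCount M 13 5 ≤ 15506 := by omega
      exact cellA _ 43796 147 _ hU' hSkit (by norm_num) (by norm_num) (by norm_num [Nat.choose]) hA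
    push Not at h42
    by_cases h52 : 2 ≤ {C : Set α | M.IsCircuit C ∧ C.ncard = 5}.ncard
    · -- two `5`-circuits: their union has `≤ 10` points
      obtain ⟨C₁, C₂, hC₁, hC₂, hne⟩ := (Set.one_lt_ncard_iff h5fin).1 (by omega)
      have hhit := S2.top_five_inter_union_nonempty M hR hn hC₁.1 hC₂.1 hne
      have h5b := htop5_le (C₁ ∪ C₂) (C₁ ∪ C₂) hhit hhit
      rw [Set.union_self] at h5b
      have hY := hcompl hC₁.1.subset_ground hC₂.1.subset_ground
      rw [hC₁.2, hC₂.2] at hY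
      have hch : (9 : ℕ).choose 5 ≤ (M.E \ (C₁ ∪ C₂)).ncard.choose 5 := Nat.choose_le_choose 5 (by omega)
      norm_num [Nat.choose] at hch
      have hU' : Matroid.topCount M 13 5 ≤ 12797 := by omega
      exact cellA _ 43796 147 _ hU' hSkit (by norm_num) (by norm_num) (by norm_num [Nat.choose]) hA
    · push Not at h52
      have hU' : Matroid.topCount M 13 5 ≤ 11859 := by omega
      exact cellA _ 43796 147 _ hU' hSkit (by norm_num) (by norm_num) (by norm_num [Nat.choose]) hA
  by_cases ht1 : t = 1
  · subst ht1
    obtain ⟨T, hTeq⟩ := Set.ncard_eq_one.1 ht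
    have hT : M.IsCircuit T ∧ T.ncard = 3 := by
      have : T ∈ {C : Set α | M.IsCircuit C ∧ C.ncard = 3} := by rw [hTeq]; exact Set.mem_singleton T
      exact this
    by_cases h41 : 1 ≤ {C : Set α | M.IsCircuit C ∧ C.ncard = 4}.ncard
    · -- the triangle and a `4`-circuit: their union has `≤ 7` points
      obtain ⟨C, hC⟩ := Set.nonempty_of_ncard_ne_zero (s := {C : Set α | M.IsCircuit C ∧ C.ncard = 4}) (by omega)
      have hne : T ≠ C := fun h => by have h3 := hT.2; rw [h, hC.2] at h3; omega
      have hhit := S2.top_five_inter_union_nonempty M hR hn hT.1 hC.1 hne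
      have h5b := htop5_le (T ∪ C) (T ∪ C) hhit hhit
      rw [Set.union_self] at h5b
      have hY := hcompl hT.1.subset_ground hC.1.subset_ground
      rw [hT.2, hC.2] at hY
      have hch : (12 : ℕ).choose 5 ≤ (M.E \ (T ∪ C)).ncard.choose 5 := Nat.choose_le_choose 5 (by omega)
      norm_num [Nat.choose] at hch
      have hU' : Matroid.topCount M 13 5 ≤ 15736 := by omega
      exact cellA _ 43796 149 _ hU' hSkit (by norm_num) (by norm_num) (by norm_num [Nat.choose]) hA
    push Not at h41
    by_cases h51 : 1 ≤ {C : Set α | M.IsCircuit C ∧ C.ncard = 5}.ncard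
    · -- the triangle and a `5`-circuit: their union has `≤ 8` points
      obtain ⟨C, hC⟩ := Set.nonempty_of_ncard_ne_zero (s := {C : Set α | M.IsCircuit C ∧ C.ncard = 5}) (by omega)
      have hne : T ≠ C := fun h => by have h3 := hT.2; rw [h, hC.2] at h3; omega
      have hhit := S2.top_five_inter_union_nonempty M hR hn hT.1 hC.1 hne
      have h5b := htop5_le (T ∪ C) (T ∪ C) hhit hhit
      rw [Set.union_self] at h5b
      have hY := hcompl hT.1.subset_ground hC.1.subset_ground
      rw [hT.2, hC.2] at hY
      have hch : (11 : ℕ).choose 5 ≤ (M.E \ (T ∪ C)).ncard.choose 5 := Nat.choose_le_choose 5 (by omega)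
      norm_num [Nat.choose] at hch
      have hU' : Matroid.topCount M 13 5 ≤ 12916 := by omega
      exact cellA _ 43796 149 _ hU' hSkit (by norm_num) (by norm_num) (by norm_num [Nat.choose]) hA
    · push Not at h51
      have hU' : Matroid.topCount M 13 5 ≤ 12300 := by omega
      exact cellA _ 43796 149 _ hU' hSkit (by norm_num) (by norm_num) (by norm_num [Nat.choose]) hA
  by_cases ht2 : t = 2
  · subst ht2
    obtain ⟨T₁, T₂, hT₁, hT₂, hne⟩ := (Set.one_lt_ncard_iff hTfin).1 (by omega)
    have hhit := S2.top_five_inter_union_nonempty M hR hn hT₁.1 hT₂.1 hne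
    have h5b := htop5_le (T₁ ∪ T₂) (T₁ ∪ T₂) hhit hhit
    rw [Set.union_self] at h5b
    have hY := hcompl hT₁.1.subset_ground hT₂.1.subset_ground
    rw [hT₁.2, hT₂.2] at hY
    have hch : (13 : ℕ).choose 5 ≤ (M.E \ (T₁ ∪ T₂)).ncard.choose 5 := Nat.choose_le_choose 5 (by omega)
    norm_num [Nat.choose] at hch
    have hU' : Matroid.topCount M 13 5 ≤ 15801 := by omega
    exact cellA _ 43796 151 _ hU' hSkit (by norm_num) (by norm_num) (by norm_num [Nat.choose]) hA
  -- `t = 3`: a top `5`-set misses at most one of three triangles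
  have ht3e : t = 3 := by omega
  subst ht3e
  have hS' := hspan3 le_rfl
  have htop5_3 : {B : Set α | B ⊆ M.E ∧ B.ncard = 5 ∧ M.eRk B = 5 ∧ M.eRk (M.E \ B) = M.eRank}.ncard ≤ 9846 := by
    obtain ⟨T₁, T₂, T₃, hT₁, hT₂, hT₃, h12, h13, h23⟩ := (Set.two_lt_ncard_iff hTfin).1 (by omega)
    obtain ⟨hT₁c, hT₁3⟩ := hT₁
    obtain ⟨hT₂c, hT₂3⟩ := hT₂
    obtain ⟨hT₃c, hT₃3⟩ := hT₃
    have hhit₂ := S2.top_five_inter_union_nonempty M hR hn hT₁c hT₂c h12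
    have hhit₃ := S2.top_five_inter_union_nonempty M hR hn hT₁c hT₃c h13
    have h5b := htop5_le (T₁ ∪ T₂) (T₁ ∪ T₃) hhit₂ hhit₃
    have hY₁ : T₁ ∪ T₂ ⊆ M.E := Set.union_subset hT₁c.subset_ground hT₂c.subset_ground
    have hY₂ : T₁ ∪ T₃ ⊆ M.E := Set.union_subset hT₁c.subset_ground hT₃c.subset_ground
    have ha := Set.ncard_sdiff_add_ncard_of_subset hY₁ M.ground_finite
    have hb := Set.ncard_sdiff_add_ncard_of_subset hY₂ M.ground_finite
    have hu12 := Set.ncard_union_le T₁ T₂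
    have hu13 := Set.ncard_union_le T₁ T₃
    have hl12 := S2.five_le_ncard_union_of_triangles M hC1 hT₁c hT₁3 hT₂c hT₂3 h12
    have hl13 := S2.five_le_ncard_union_of_triangles M hC1 hT₁c hT₁3 hT₃c hT₃3 h13
    have hu123 : (T₁ ∪ T₂ ∪ (T₁ ∪ T₃)).ncard ≤ 9 := by
      have hsub : T₁ ∪ T₂ ∪ (T₁ ∪ T₃) ⊆ (T₁ ∪ T₂) ∪ T₃ :=
        Set.union_subset Set.subset_union_left
          (Set.union_subset (Set.subset_union_left.trans Set.subset_union_left) Set.subset_union_right)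
      have h1 := Set.ncard_le_ncard hsub (((hfin hT₁c).union (hfin hT₂c)).union (hfin hT₃c))
      have h2 := Set.ncard_union_le (T₁ ∪ T₂) T₃
      omega
    have hc := Set.ncard_sdiff_add_ncard_of_subset (Set.union_subset hY₁ hY₂) M.ground_finite
    obtain ⟨x, hx₃, hx₁₂⟩ := exists_mem_triangle_notMem_union M hC1 hT₁c hT₁3 hT₂c hT₂3 hT₃c hT₃3 h13 h23
    obtain ⟨y, hy₂, hy₁₃⟩ := exists_mem_triangle_notMem_union M hC1 hT₁c hT₁3 hT₃c hT₃3 hT₂c hT₂3 h12 (Ne.symm h23)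
    have hca : (M.E \ (T₁ ∪ T₂ ∪ (T₁ ∪ T₃))).ncard + 1 ≤ (M.E \ (T₁ ∪ T₂)).ncard := by
      have hxmem : x ∈ M.E \ (T₁ ∪ T₂) := ⟨hT₃c.subset_ground hx₃, hx₁₂⟩
      have hsub : M.E \ (T₁ ∪ T₂ ∪ (T₁ ∪ T₃)) ⊆ (M.E \ (T₁ ∪ T₂)) \ {x} := by
        rintro z ⟨hzE, hz⟩
        refine ⟨⟨hzE, fun h => hz (Or.inl h)⟩, fun hzx => hz (Or.inr (Or.inr (by rw [Set.mem_singleton_iff.1 hzx]; exact hx₃)))⟩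
      have := Set.ncard_le_ncard hsub (M.ground_finite.sdiff.sdiff)
      have h1 := Set.ncard_sdiff_singleton_add_one hxmem (M.ground_finite.sdiff)
      omega
    have hcb : (M.E \ (T₁ ∪ T₂ ∪ (T₁ ∪ T₃))).ncard + 1 ≤ (M.E \ (T₁ ∪ T₃)).ncard := by
      have hymem : y ∈ M.E \ (T₁ ∪ T₃) := ⟨hT₂c.subset_ground hy₂, hy₁₃⟩
      have hsub : M.E \ (T₁ ∪ T₂ ∪ (T₁ ∪ T₃)) ⊆ (M.E \ (T₁ ∪ T₃)) \ {y} := by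
        rintro z ⟨hzE, hz⟩
        refine ⟨⟨hzE, fun h => hz (Or.inr h)⟩, fun hzy => hz (Or.inl (Or.inr (by rw [Set.mem_singleton_iff.1 hzy]; exact hy₂)))⟩
      have := Set.ncard_le_ncard hsub (M.ground_finite.sdiff.sdiff)
      have h1 := Set.ncard_sdiff_singleton_add_one hymem (M.ground_finite.sdiff)
      omega
    exact top_five_le_of_three_bound19 {B : Set α | B ⊆ M.E ∧ B.ncard = 5 ∧ M.eRk B = 5 ∧ M.eRk (M.E \ B) = M.eRank}.ncard
      _ _ _ (by omega) (by omega) (by omega) (by omega) (by omega) (by omega) hca hcb h5b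
  have hU' : Matroid.topCount M 13 5 ≤ 15866 := by omega
  exact cellA _ 28781 124 _ hU' hS' (by norm_num) (by norm_num) (by norm_num [Nat.choose]) hA

/-- **THE CELL `(13, 6)` MODULO THE SPREAD CAPS `(30, 77, 112)` on its coloop-free spread core**: `RLS M 13 5` for every
`e`-free core of rank `13` on `19` points, given `s₄ ≤ 30`, `s₅ ≤ 77`, `s₆ ≤ 112` on every coloop-free spread core of that size
(p1's spread chains; hypothesis `hcaps`). Nothing about the cell is claimed unconditionally. -/
theorem c025_core_five_thirteen_six_of_caps
    (hcaps : ∀ (M : Matroid α) [M.Finite], M.eRank = ((13 : ℕ) : ℕ∞) → M.E.ncard = 13 + 6 →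
      (∀ e ∈ M.E, ∃ A ⊆ M.E \ {e}, e ∉ M.closure A ∧ e ∉ M.closure ((M.E \ {e}) \ A)) → (∀ e, ¬ M.IsColoop e) →
      ¬ (∃ W ⊆ M.E, W.ncard ≤ 9 ∧ W.encard = M.eRk W + 4) →
      {C : Set α | M.IsCircuit C ∧ C.ncard = 4}.ncard ≤ 30 ∧ {C : Set α | M.IsCircuit C ∧ C.ncard = 5}.ncard ≤ 77 ∧
        {C : Set α | M.IsCircuit C ∧ C.ncard = 6}.ncard ≤ 112)
    (M : Matroid α) [M.Finite]
    (hR : M.eRank = ((13 : ℕ) : ℕ∞)) (hn : M.E.ncard = 13 + 6)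
    (hfree : ∀ e ∈ M.E, ∃ A ⊆ M.E \ {e}, e ∉ M.closure A ∧ e ∉ M.closure ((M.E \ {e}) \ A)) : RLS M 13 5 := by
  refine c025_core_five_thirteen_six_of_three (fun M' _ hR' hn' hfree' hK' h4' ht3' => ?_) M hR hn hfree
  obtain ⟨hs4c, hs5c, hs6c⟩ := hcaps M' hR' hn' hfree' hK' h4'
  exact c025_thirteen_six_cf_spread_le_three_of_caps M' hR' hn' hfree' hK' h4' hs4c hs5c hs6c ht3'

end ThmN

end PercRepro
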